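import Literature.AnabelianGeometry.SemiGraphs.TemperedReconstructionReductionsProofs
import Literature.AnabelianGeometry.SemiGraphs.TemperedCompactInVerticialAt
import HarnessLib

/-!
# Semi-graphs of anabelioids, §3: Corollary 3.9, step (a) AT ONE PAIR OF GRAPHS (φ2-consumers twin of R0)

Mochizuki, *Semi-graphs of anabelioids*, Publ. RIMS **42** (2006), §3, Corollary 3.9, proof, manuscript
p. 42 [cite: MochizukiSemiAnbd2006, Cor 3.9 p.42]: "any locally open morphism of semi-graphs of
anabelioids `G → H` determines a morphism of temperoids `B^temp(G) → B^temp(H)` [cf. Proposition 3.6,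
(iv)] whose quasi-geometricity follows by 'substituting' the equivalences of Theorem 3.7, (iv), into
Definition 3.8."

PROOF-ONLY companion (abc-iut cell, L3-lead ruling α4-3 «φ2-CONSUMERS», block B0a, seat abc-iut-L3-d1)
of `TemperedReconstructionReductionsProofs.lean`: the SAME proof of the residual R0
(`InducedIsQuasiGeometric_of`), with the ∀-countable named fact `MaximalCompactIffVerticial` (Thm. 3.7
(iv) for EVERY countable `𝒢`) replaced by its per-graph form `MaximalCompactIffVerticialAt`
(`TemperedCompactInVerticialAt.lean`, abc-iut-w4-d075) at the two graphs `𝒢`, `ℋ` where the proof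
instantiates it — so that the finite-`𝔾` producer of Thm. 3.7 (iii) (print's route, p. 41 "since the
semi-graphs `𝔾_j` are all finite") feeds the Cor. 3.9 chain BY NAME.  Since the conclusion
`InducedIsQuasiGeometric` is itself a ∀-statement over pairs of graphs, the twin concludes its BODY at
the pair `(𝒢, ℋ)` (stated inline; no new definition).  Port rule (α4-3): binder
`(h37iv : MaximalCompactIffVerticial)` ↦ `(h37iv𝒢 : MaximalCompactIffVerticialAt 𝒢)`,
`(h37ivℋ : MaximalCompactIffVerticialAt ℋ)`; `h37iv X hX c ↦ h37ivX hX c`; everything else verbatim.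
The original file is untouched.  Nothing here takes a side on [IUTchIII] Cor. 3.12; typed ≠ discharged.
-/

open CategoryTheory Topology

namespace Literature.AnabelianGeometry.SemiGraphs

namespace ProfiniteSemiGraph

universe u

variable {𝒢 ℋ : ProfiniteSemiGraph.{u}}

/-! ### Local copies of the three private lemmas of the original file -/

/-- A closed edge has a branch abutting to a vertex. [cite: MochizukiSemiAnbd2006, §1 p.12] -/
private theorem exists_branch_of_isClosedEdge {G : SemiGraph.{u}} {e : G.Edge}
    (he : G.IsClosedEdge e) : ∃ (c : G.Branch) (w : G.Vertex), G.edgeOf c = e ∧ G.abuts c = some w := by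
  unfold SemiGraph.IsClosedEdge SemiGraph.vertCard at he
  obtain ⟨x, -, -, -⟩ := Nat.card_eq_two_iff.mp he
  obtain ⟨w, hw⟩ := Option.isSome_iff_exists.mp x.2.2
  exact ⟨x.1, w, x.2.1, hw⟩

/-- A morphism of semi-graphs maps closed edges to closed edges. [cite: MochizukiSemiAnbd2006, §1 p.12] -/
private theorem isClosedEdge_edgeMap' {G H : SemiGraph.{u}} (φ : G ⟶ H) {e : G.Edge}
    (he : G.IsClosedEdge e) : H.IsClosedEdge (φ.edgeMap e) := by
  unfold SemiGraph.IsClosedEdge SemiGraph.vertCard at he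
  obtain ⟨x, y, hxy, -⟩ := Nat.card_eq_two_iff.mp he
  obtain ⟨w, hw⟩ := Option.isSome_iff_exists.mp x.2.2
  obtain ⟨w', hw'⟩ := Option.isSome_iff_exists.mp y.2.2
  refine SemiGraph.isClosedEdge_of_abuts (c := φ.branchMap x.1) (c' := φ.branchMap y.1)
    (fun h => hxy (Subtype.ext (φ.branchMap_injOn x.1 y.1 (x.2.1.trans y.2.1.symm) h))) ?_ ?_
    (φ.abuts_branchMap x.1 w hw) (φ.abuts_branchMap y.1 w' hw')
  · rw [φ.edgeOf_branchMap, x.2.1]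
  · rw [φ.edgeOf_branchMap, y.2.1]

/-- The image description common to both clauses: from `φ (ψ x) = g * ψ' (η x) * g⁻¹` for all `x`,
`φ(ψ(Π)) = j(η(Π))` with `j = γ_g ∘ ψ'`, and `j(⊤) = γ_g(ψ'(⊤))`. [folklore] -/
private theorem map_range_eq {P : Type u} [Group P] {Γ : Type u} [Group Γ] {A B : Type u} [Group A]
    [Group B] (φ : P →* Γ) (ψ : A →* P) (ψ' : B →* Γ) (η : A →* B) (g : Γ)
    (hg : ∀ x, φ (ψ x) = g * ψ' (η x) * g⁻¹) :
    ψ.range.map φ = η.range.map ((MulAut.conj g).toMonoidHom.comp ψ') ∧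
      (⊤ : Subgroup B).map ((MulAut.conj g).toMonoidHom.comp ψ') =
        ψ'.range.map (MulAut.conj g).toMonoidHom := by
  constructor
  · ext y
    constructor
    · rintro ⟨_, ⟨x, rfl⟩, rfl⟩
      exact ⟨η x, ⟨x, rfl⟩, (hg x).symm⟩
    · rintro ⟨_, ⟨x, rfl⟩, rfl⟩
      exact ⟨ψ x, ⟨x, rfl⟩, hg x⟩
  · rw [MonoidHom.range_eq_map, Subgroup.map_map]

/-! ### R0 at the pair `(𝒢, ℋ)` from Theorem 3.7 (i) and Theorem 3.7 (iv) AT `𝒢` and AT `ℋ` -/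

/-- **R0 at one pair of graphs, from Thm. 3.7 (i) and Thm. 3.7 (iv) at `𝒢` and at `ℋ`** ([SemiAnbd]
Cor. 3.9, proof, p. 42: "whose quasi-geometricity follows by 'substituting' the equivalences of Theorem
3.7, (iv), into Definition 3.8"): for graphs `𝒢`, `ℋ` as in Cor. 3.9, a homomorphism
`φ : π₁^temp(𝒢) → π₁^temp(ℋ)` compatible with a locally open morphism `F : 𝒢 → ℋ` on verticial and
edge homomorphisms is quasi-geometric — the body of `InducedIsQuasiGeometric` at `(𝒢, ℋ)`, with the
per-graph Thm. 3.7 (iv) inputs `MaximalCompactIffVerticialAt 𝒢`, `MaximalCompactIffVerticialAt ℋ`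
(φ2-consumers twin of `InducedIsQuasiGeometric_of`). [cite: MochizukiSemiAnbd2006, Cor 3.9 p.42] -/
theorem InducedIsQuasiGeometric_of_at (h37i : VerticialInjective.{u})
    (h37iv𝒢 : MaximalCompactIffVerticialAt 𝒢) (h37ivℋ : MaximalCompactIffVerticialAt ℋ)
    (h𝒢 : Cor39Hypotheses 𝒢) (hℋ : Cor39Hypotheses ℋ) (c𝒢 : TemperedPiChart 𝒢)
    (cℋ : TemperedPiChart ℋ) (F : Hom 𝒢 ℋ) (φ : c𝒢.G →ₜ* cℋ.G) (hF : F.IsLocallyOpen)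
    (hV : F.CompatV c𝒢 cℋ φ) (hE : F.CompatE c𝒢 cℋ φ) : IsQuasiGeometric φ := by
  haveI := cℋ.t2Space
  have h37𝒢 := h𝒢.thm37Hypotheses
  have h37ℋ := hℋ.thm37Hypotheses
  obtain ⟨hmax𝒢, hint𝒢⟩ := h37iv𝒢 h37𝒢 c𝒢
  obtain ⟨hmaxℋ, hintℋ⟩ := h37ivℋ h37ℋ cℋ
  refine ⟨fun K₁ hK₁ => ?_, fun K₁ H₁ hK₁ hH₁ hne hnt => ?_⟩
  · -- maximal compact subgroups
    obtain ⟨v, ψ, ⟨eψ⟩, rfl⟩ := (hmax𝒢 K₁).mp hK₁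
    obtain ⟨⟨_, ψ₁, ⟨e₁⟩, rfl⟩, hinj₁⟩ := h37i ℋ h37ℋ cℋ (F.base.vertexMap v)
    obtain ⟨g, hg⟩ := hV v ψ ψ₁ ⟨eψ⟩ ⟨e₁⟩
    let j : ℋ.Gv (F.base.vertexMap v) →* cℋ.G := (MulAut.conj g).toMonoidHom.comp ψ₁.toMonoidHom
    have hjc : Continuous j :=
      ((continuous_const.mul ψ₁.continuous).mul continuous_const :)
    have hj : Function.Injective j := fun a b h => hinj₁ ψ₁ ⟨e₁⟩ ((MulAut.conj g).injective h)
    obtain ⟨hK, htop⟩ := map_range_eq φ.toMonoidHom ψ.toMonoidHom ψ₁.toMonoidHom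
      (F.hV v).toMonoidHom g hg
    refine ⟨(⊤ : Subgroup _).map j, (hmaxℋ _).mpr ⟨F.base.vertexMap v, ?_⟩,
      mapsOntoOpenSubgroupOf_of_eq_map j hjc hj φ.toMonoidHom _ _ (hF.1 v) hK⟩
    rw [htop]
    exact conj_mem_verticialSubgroups cℋ ⟨ψ₁, ⟨e₁⟩, rfl⟩ g
  · -- nontrivial intersections of two distinct maximal compact subgroups
    obtain ⟨e, he, ψ, ⟨eψ⟩, hL⟩ := (hint𝒢 (K₁ ⊓ H₁) hnt).mp ⟨K₁, H₁, hK₁, hH₁, hne, rfl⟩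
    rw [hL]
    -- a branch `b` of the closed edge `F e`, abutting to `w`
    have he' : ℋ.graph.IsClosedEdge (F.base.edgeMap e) := isClosedEdge_edgeMap' F.base he
    obtain ⟨b, w, hbe, hbw⟩ := exists_branch_of_isClosedEdge he'
    -- an edge homomorphism at `F e`: `ψ_w ∘ b_*`, injective
    obtain ⟨⟨_, ψw, ⟨ew⟩, rfl⟩, hinjw⟩ := h37i ℋ h37ℋ cℋ w
    have key : ∀ (f : ℋ.graph.Edge) (hf : ℋ.graph.edgeOf b = f), ℋ.graph.IsClosedEdge f →
        ∀ (η : 𝒢.Ge e →ₜ* ℋ.Ge f), IsOpen (η.toMonoidHom.range : Set (ℋ.Ge f)) →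
        (∀ ψ' : ℋ.Ge f →ₜ* cℋ.G, IsEdgeHom cℋ f ψ' → ∃ g : cℋ.G, ∀ x, φ (ψ x) = g * ψ' (η x) * g⁻¹) →
        ∃ K₂ H₂ : Subgroup cℋ.G, IsMaximalCompactSubgroup K₂ ∧ IsMaximalCompactSubgroup H₂ ∧
          K₂ ≠ H₂ ∧ K₂ ⊓ H₂ ≠ ⊥ ∧
          MapsOntoOpenSubgroupOf φ.toMonoidHom ψ.toMonoidHom.range (K₂ ⊓ H₂) := by
      intro f hf hfc η hη hcomp
      subst hf
      let ψ' : ℋ.Ge (ℋ.graph.edgeOf b) →ₜ* cℋ.G := ψw.comp (ℋ.brHom b w hbw)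
      have hψ' : IsEdgeHom cℋ (ℋ.graph.edgeOf b) ψ' := isEdgeHom_comp_brHom cℋ hbw ⟨ew⟩
      have hinj' : Function.Injective ψ' :=
        (hinjw ψw ⟨ew⟩).comp (hℋ.isOfInjectiveType b w hbw)
      obtain ⟨g, hg⟩ := hcomp ψ' hψ'
      let j : ℋ.Ge (ℋ.graph.edgeOf b) →* cℋ.G := (MulAut.conj g).toMonoidHom.comp ψ'.toMonoidHom
      have hjc : Continuous j := ((continuous_const.mul ψ'.continuous).mul continuous_const :)
      have hj : Function.Injective j := fun a a' h => hinj' ((MulAut.conj g).injective h)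
      obtain ⟨hK, htop⟩ := map_range_eq φ.toMonoidHom ψ.toMonoidHom ψ'.toMonoidHom
        η.toMonoidHom g hg
      -- the target edge-like subgroup `j(Π_{F e})`, nontrivial
      have hL₂ : (⊤ : Subgroup _).map j ∈ edgeLikeSubgroups cℋ (ℋ.graph.edgeOf b) := by
        rw [htop]
        exact conj_mem_edgeLikeSubgroups' cℋ ⟨ψ', hψ', rfl⟩ g
      haveI : Infinite (ℋ.Gv w) := infinite_gv_of_isElevatedVertex (hℋ.isTotallyElevated w)
      haveI : Nontrivial (ℋ.Ge (ℋ.graph.edgeOf b)) :=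
        nontrivial_ge_of_isAloofEdge hbw (hℋ.isTotallyAloof _)
      have hL₂ne : (⊤ : Subgroup _).map j ≠ ⊥ := by
        intro h0
        obtain ⟨x, hx⟩ := exists_ne (1 : ℋ.Ge (ℋ.graph.edgeOf b))
        have : j x ∈ ((⊤ : Subgroup _).map j) := ⟨x, Subgroup.mem_top x, rfl⟩
        rw [h0, Subgroup.mem_bot, ← map_one j] at this
        exact hx (hj this)
      obtain ⟨K₂, H₂, hK₂, hH₂, hne₂, hKH⟩ := (hintℋ _ hL₂ne).mpr ⟨_, hfc, hL₂⟩
      refine ⟨K₂, H₂, hK₂, hH₂, hne₂, hKH ▸ hL₂ne, ?_⟩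
      rw [← hKH]
      exact mapsOntoOpenSubgroupOf_of_eq_map j hjc hj φ.toMonoidHom _ _ hη hK
    exact key (F.base.edgeMap e) hbe he' (F.hE e) (hF.2 e) fun ψ' hψ' => hE e ψ ψ' ⟨eψ⟩ hψ'

end ProfiniteSemiGraph

end Literature.AnabelianGeometry.SemiGraphs
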